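import Literature.MathematicalPhysics.QuantumFieldTheory.Federbush1986.PhaseCellIVLatticeHierarchy

/-!
# Federbush, *A phase cell approach to Yang–Mills theory. IV. The choice of variables* (CMP **114** (1988) 317–343) —
# §11 pp. 336–337, the incidence counts of a hypercube of `ℒ^r`: «plaquettes in its boundary (24 in number)», «It will belong
# to a number of hypercubes (eight in number)», and the *large field hypercubes* — TYPED and the counts PROVED (`d = 4`)

statement-level skeleton of published theorems with citation tags; proofs where landed; nothing here is a claim about the Yang–Mills mass gap

Cell `lit-balaban`, reader/typer block **r19** (F4 fold owner), inventory row `F4.Def§11` of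
`run/shared/lean/pub/lit-balaban/lit-balaban-r19/ROWS-F4.md`; companion of `PhaseCellIVLatticeHierarchy` (§1: `pos`, `edgeLen`,
`cube`, `LEdge`) and `PhaseCellIVGaugeInterpolation` (§11; the vertex/edge counts `2⁴`, `2⁵` of the hypercube are there).

**Source.** P. Federbush, Commun. Math. Phys. **114** (1988) 317–343 [bib `Federbush1988PhaseCellIV`; lit store
`paper:doi-10-1007-bf01225039`; journal page = PDF page + 316], p. 336 [PDF 20] and p. 337 [PDF 21] READ AS IMAGES (renders
`lit-balaban-r19/renders/f4/f4-p020.png`, `f4-p021.png`).  Verbatim, p. 336: «We call a hypercube *large field*, if any of the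
plaquettes in its boundary (24 in number) are large field.  We choose the gauge assigned to such a hypercube to be the
restriction of the gauge assigned (at the last inductive step) to the hypercube of one larger scale containing it.»  p. 337:
«Let `e` be an edge in `ℰ^r`.  It will belong to a number of hypercubes (eight in number).»

**What this file does** (dimension `d`, print `d = 4`; a hypercube of `ℒ^r` is labelled by its lowest corner `n ∈ ℤ^d`, cf.
`PhaseCellIVLattice.cube`):
* `LPlaq d` — a plaquette of `ℒ^r` by lowest corner and two directions; `boundaryPlaqs n` — the plaquettes in the boundary of the
  hypercube `n`: directions `μ < ν`, lowest corner `n + ε` with `ε ∈ {0,1}^d`, `ε_μ = ε_ν = 0` (the 2-faces); **`card = 24` for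
  `d = 4`** (`card_boundaryPlaqs_four`), PROVED;
* `cubesContaining e` — the hypercubes of the same level containing the edge `e = (n, μ)`: lowest corners `n − ε`, `ε ∈ {0,1}^d`,
  `ε_μ = 0`; both end points of `e` lie in each of them (`src_mem_cube`, `tgt_mem_cube`), **`card = 8` for `d = 4`**
  (`card_cubesContaining_four`), PROVED;
* `IsLargeFieldCube` — «large field, if any of the plaquettes in its boundary are large field», for a given `S`/`L` labelling of
  the plaquettes (a parameter: the `S − L` configuration of §§2, 5).
No `sorry`, no `Prop`-facts.
-/

namespace Literature.MathematicalPhysics.QuantumFieldTheory.Federbush1986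

noncomputable section

open Set Finset

namespace PhaseCellIVLattice

variable {d : ℕ}

/-! ## 1. Plaquettes and the boundary plaquettes of a hypercube -/

/-- A plaquette of `ℒ^r`: lowest corner `src ∈ ℤ^d` and the two directions it spans (used with `dir₁ < dir₂`).
[cite: Federbush1988PhaseCellIV, §1 p. 322 («The set of *plaquettes* of `ℒ^r` we denote as `𝒫^r`»)] -/
structure LPlaq (d : ℕ) where
  /-- lowest corner -/
  src : Fin d → ℤ
  /-- first direction -/
  dir₁ : Fin d
  /-- second direction -/
  dir₂ : Fin d
  deriving DecidableEq

/-- The offset vector `ε ∈ {0,1}^d ⊂ ℤ^d`. [cite: Federbush1988PhaseCellIV, §11 p. 336] -/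
def offs (ε : Fin d → Fin 2) : Fin d → ℤ := fun k => ((ε k : ℕ) : ℤ)

/-- `offs` is injective. [cite: Federbush1988PhaseCellIV, §11 p. 336] -/
theorem offs_injective : Function.Injective (offs (d := d)) := by
  intro ε ε' h
  funext k
  have := congrFun h k
  simp only [offs, Nat.cast_inj] at this
  exact Fin.ext this

/-- The parameters of the boundary plaquettes of a hypercube: directions `μ < ν` and an offset `ε ∈ {0,1}^d` with
`ε_μ = ε_ν = 0` (the position of the 2-face in the remaining `d − 2` directions). [cite: Federbush1988PhaseCellIV, §11 p. 336] -/
def bdryParams (d : ℕ) : Finset (Fin d × Fin d × (Fin d → Fin 2)) :=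
  Finset.univ.filter fun q => q.1 < q.2.1 ∧ q.2.2 q.1 = 0 ∧ q.2.2 q.2.1 = 0

/-- The boundary plaquette of the hypercube `n` with parameters `(μ, ν, ε)`: lowest corner `n + ε`, directions `μ, ν`.
[cite: Federbush1988PhaseCellIV, §11 p. 336] -/
def bdryPlaq (n : Fin d → ℤ) (q : Fin d × Fin d × (Fin d → Fin 2)) : LPlaq d := ⟨n + offs q.2.2, q.1, q.2.1⟩

/-- Different parameters give different plaquettes. [cite: Federbush1988PhaseCellIV, §11 p. 336] -/
theorem bdryPlaq_injective (n : Fin d → ℤ) : Function.Injective (bdryPlaq n) := by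
  rintro ⟨μ, ν, ε⟩ ⟨μ', ν', ε'⟩ h
  simp only [bdryPlaq, LPlaq.mk.injEq, add_right_inj] at h
  obtain ⟨h1, h2, h3⟩ := h
  rw [offs_injective h1, h2, h3]

/-- «the plaquettes in its boundary»: the 2-faces of the hypercube with lowest corner `n`, as plaquettes of the same lattice.
[cite: Federbush1988PhaseCellIV, §11 p. 336] -/
def boundaryPlaqs (n : Fin d → ℤ) : Finset (LPlaq d) := (bdryParams d).image (bdryPlaq n)

/-- The number of boundary plaquettes does not depend on the hypercube. [cite: Federbush1988PhaseCellIV, §11 p. 336] -/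
theorem card_boundaryPlaqs (n : Fin d → ℤ) : (boundaryPlaqs n).card = (bdryParams d).card :=
  Finset.card_image_of_injective _ (bdryPlaq_injective n)

/-- **«(24 in number)»**: a four-dimensional hypercube has `24` boundary plaquettes (`C(4,2)·2²`).
[cite: Federbush1988PhaseCellIV, §11 p. 336] -/
theorem card_boundaryPlaqs_four (n : Fin 4 → ℤ) : (boundaryPlaqs n).card = 24 := by
  rw [card_boundaryPlaqs]
  decide

/-- A boundary plaquette spans two different directions, in increasing order. [cite: Federbush1988PhaseCellIV, §11 p. 336] -/
theorem dir_lt_of_mem_boundaryPlaqs {n : Fin d → ℤ} {p : LPlaq d} (hp : p ∈ boundaryPlaqs n) : p.dir₁ < p.dir₂ := by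
  simp only [boundaryPlaqs, Finset.mem_image, bdryParams, Finset.mem_filter, Finset.mem_univ, true_and] at hp
  obtain ⟨q, ⟨hq, -, -⟩, rfl⟩ := hp
  exact hq

/-- A lattice point whose integer coordinates lie in `[n_k, n_k + 1]` belongs to the closed hypercube with lowest corner `n`.
[cite: Federbush1988PhaseCellIV, §11 p. 336] -/
theorem pos_mem_cube {N : ℕ} (hN : 0 < N) (r : ℕ) {v n : Fin d → ℤ} (h : ∀ k, n k ≤ v k ∧ v k ≤ n k + 1) :
    pos N r v ∈ cube N r n := by
  have hL := edgeLen_pos hN r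
  intro k
  obtain ⟨h1, h2⟩ := h k
  have h1' : (n k : ℝ) ≤ v k := by exact_mod_cast h1
  have h2' : (v k : ℝ) ≤ n k + 1 := by exact_mod_cast h2
  simp only [pos_apply]
  constructor <;> nlinarith

/-- The four corners of a boundary plaquette lie in the (closed) hypercube: for `p = (n + ε, μ, ν)` every corner
`n + ε + a e_μ + b e_ν`, `a, b ∈ {0,1}`, has coordinates in `[n_k, n_k + 1]`. [cite: Federbush1988PhaseCellIV, §11 p. 336] -/
theorem corner_mem_cube {N : ℕ} (hN : 0 < N) (r : ℕ) {n : Fin d → ℤ} {p : LPlaq d} (hp : p ∈ boundaryPlaqs n) (a b : Fin 2) :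
    pos N r (p.src + Pi.single p.dir₁ ((a : ℕ) : ℤ) + Pi.single p.dir₂ ((b : ℕ) : ℤ)) ∈ cube N r n := by
  simp only [boundaryPlaqs, Finset.mem_image, bdryParams, Finset.mem_filter, Finset.mem_univ, true_and] at hp
  obtain ⟨⟨μ, ν, ε⟩, ⟨hμν, hε1, hε2⟩, rfl⟩ := hp
  dsimp only at hμν hε1 hε2
  refine pos_mem_cube hN r fun k => ?_
  have hεk : ((ε k : ℕ) : ℤ) ≤ 1 := by have := (ε k).isLt; omega
  have ha : ((a : ℕ) : ℤ) ≤ 1 := by have := a.isLt; omega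
  have hb : ((b : ℕ) : ℤ) ≤ 1 := by have := b.isLt; omega
  by_cases hk1 : k = μ
  · subst hk1
    have h0 : ((ε k : ℕ) : ℤ) = 0 := by rw [hε1]; rfl
    simp only [bdryPlaq, Pi.add_apply, offs, h0, Pi.single_eq_same, Pi.single_eq_of_ne (ne_of_lt hμν)]
    omega
  · by_cases hk2 : k = ν
    · subst hk2
      have h0 : ((ε k : ℕ) : ℤ) = 0 := by rw [hε2]; rfl
      simp only [bdryPlaq, Pi.add_apply, offs, h0, Pi.single_eq_of_ne hk1, Pi.single_eq_same]
      omega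
    · simp only [bdryPlaq, Pi.add_apply, offs, Pi.single_eq_of_ne hk1, Pi.single_eq_of_ne hk2]
      omega

/-! ## 2. The hypercubes containing an edge -/

/-- The parameters of the hypercubes containing the edge `(n, μ)`: offsets `ε ∈ {0,1}^d` with `ε_μ = 0` (the cube with lowest
corner `n − ε`). [cite: Federbush1988PhaseCellIV, §11 p. 337] -/
def cubeParams (d : ℕ) (μ : Fin d) : Finset (Fin d → Fin 2) := Finset.univ.filter fun ε => ε μ = 0

/-- «It will belong to a number of hypercubes»: the lowest corners `n − ε` of the hypercubes (of the same level) containing the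
edge `e = (n, μ)`. [cite: Federbush1988PhaseCellIV, §11 p. 337] -/
def cubesContaining (e : LEdge d) : Finset (Fin d → ℤ) := (cubeParams d e.dir).image fun ε => e.src - offs ε

/-- **«(eight in number)»**: in four dimensions an edge lies in `8 = 2³` hypercubes of its level.
[cite: Federbush1988PhaseCellIV, §11 p. 337] -/
theorem card_cubesContaining_four (e : LEdge 4) : (cubesContaining e).card = 8 := by
  rw [cubesContaining, Finset.card_image_of_injective _ (fun ε ε' h => offs_injective (sub_right_injective h))]
  generalize e.dir = μ
  revert μ
  decide

/-- The tail of the edge lies in each of these hypercubes. [cite: Federbush1988PhaseCellIV, §11 p. 337] -/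
theorem src_mem_cube {N : ℕ} (hN : 0 < N) (r : ℕ) (e : LEdge d) {m : Fin d → ℤ} (hm : m ∈ cubesContaining e) :
    pos N r e.src ∈ cube N r m := by
  simp only [cubesContaining, Finset.mem_image] at hm
  obtain ⟨ε, -, rfl⟩ := hm
  refine pos_mem_cube hN r fun k => ?_
  have hεk : ((ε k : ℕ) : ℤ) ≤ 1 := by have := (ε k).isLt; omega
  simp only [Pi.sub_apply, offs]
  omega

/-- … and so does its head `n + e_μ` (because `ε_μ = 0`). [cite: Federbush1988PhaseCellIV, §11 p. 337] -/
theorem tgt_mem_cube {N : ℕ} (hN : 0 < N) (r : ℕ) (e : LEdge d) {m : Fin d → ℤ} (hm : m ∈ cubesContaining e) :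
    pos N r e.tgt ∈ cube N r m := by
  simp only [cubesContaining, cubeParams, Finset.mem_image, Finset.mem_filter, Finset.mem_univ, true_and] at hm
  obtain ⟨ε, hε, rfl⟩ := hm
  refine pos_mem_cube hN r fun k => ?_
  have hεk : ((ε k : ℕ) : ℤ) ≤ 1 := by have := (ε k).isLt; omega
  by_cases hk : k = e.dir
  · have h0 : ((ε k : ℕ) : ℤ) = 0 := by rw [hk, hε]; rfl
    simp only [LEdge.tgt, Pi.add_apply, hk, Pi.single_eq_same, Pi.sub_apply, offs] at h0 ⊢
    rw [← hk] at h0 ⊢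
    omega
  · simp only [LEdge.tgt, Pi.add_apply, Pi.single_eq_of_ne hk, add_zero, Pi.sub_apply, offs]
    omega

/-- The hypercube's own lowest corner is among them (`ε = 0`). [cite: Federbush1988PhaseCellIV, §11 p. 337] -/
theorem src_mem_cubesContaining (e : LEdge d) : e.src ∈ cubesContaining e := by
  simp only [cubesContaining, cubeParams, Finset.mem_image, Finset.mem_filter, Finset.mem_univ, true_and]
  exact ⟨0, rfl, by funext k; simp [offs]⟩

/-! ## 3. Large field hypercubes -/

/-- «We call a hypercube *large field*, if any of the plaquettes in its boundary (24 in number) are large field» — for a given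
labelling `isLarge` of the plaquettes of the level (the `S − L` configuration). [cite: Federbush1988PhaseCellIV, §11 p. 336] -/
def IsLargeFieldCube (isLarge : LPlaq d → Prop) (n : Fin d → ℤ) : Prop := ∃ p ∈ boundaryPlaqs n, isLarge p

/-- With no large-field plaquettes at all («only `S`-plaquettes at all levels», §2) no hypercube is large field.
[cite: Federbush1988PhaseCellIV, §11 p. 336; §2 p. 325] -/
theorem not_isLargeFieldCube_of_forall {isLarge : LPlaq d → Prop} (h : ∀ p, ¬isLarge p) (n : Fin d → ℤ) :
    ¬IsLargeFieldCube isLarge n := by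
  rintro ⟨p, -, hp⟩
  exact h p hp

/-- Large-fieldness is monotone in the labelling. [cite: Federbush1988PhaseCellIV, §11 p. 336] -/
theorem IsLargeFieldCube.mono {isLarge isLarge' : LPlaq d → Prop} (h : ∀ p, isLarge p → isLarge' p) {n : Fin d → ℤ}
    (hn : IsLargeFieldCube isLarge n) : IsLargeFieldCube isLarge' n := by
  obtain ⟨p, hp, hl⟩ := hn
  exact ⟨p, hp, h p hl⟩

end PhaseCellIVLattice

end

end Literature.MathematicalPhysics.QuantumFieldTheory.Federbush1986
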